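import Summits.AtomisticToContinuum.Crystallization.Theorems.ChessboardParticlePlanesPeriodicWindowsGapSqueezeCompetitor1
import Summits.AtomisticToContinuum.Crystallization.Theorems.PhononSlackCertificatesPeriodicGivenLayeredLayerCake3
import Literature.MathematicalPhysics.StatisticalMechanics.LayerSumDecay

/-!
# Crux `PeriodicWindows` (stmt-AtomisticToContinuum-3240), line `dense-laminar-hull` — stub LC-B
# `stub_offsetLayerDecay`: decay of the Lennard-Jones layer sums for a general horizontal offset

For the triangular layer lattice `{i v₁(a) + j v₂(a)}` (`a ≥ 7/10`, no upper bound) we prove: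

* the in-layer family `|V_LJ ‖i v₁ + j v₂‖|` is summable over `ℤ²` (`old_summable_abs_inLayer`);
* uniformly in a HORIZONTAL offset `θ` (`θ 2 = 0`) and for every height `|H| ≥ 7/10`, the shifted layer family
  `|V_LJ ‖i v₁ + j v₂ + θ + H e₃‖|` is summable with `∑ ≤ C(a) / H⁴`, `C(a) = 10 (100/49 + a⁻²)`
  (`old_sum_abs_layer_le`, `stub_offsetLayerDecay`).

Route (the counting argument of `Literature/…/LayerSumDecay.lean`, there for registry offsets only):
`‖i v₁ + j v₂ + θ + H e₃‖² = a² q(i,j) + H²` with the shifted planar form `q(i,j) = (i + j/2 + c₁)² + ¾ (j + c₂)²`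
(`c₁ = θ₀/a`, `c₂ = 2√3 θ₁/(3a)`); the cumulative counts `#{q < m} ≤ 10 m` hold for arbitrary REAL shifts
(`old_card_filter_lt_le`, the coordinate-box argument); `|V_LJ(r)| ≤ (r²)⁻³` for `r² ≥ 49/100`; layer-cake
summation against the counts (`sum_le_of_cumulative_count`) and the telescoping estimate
`∑_{n ≥ 0} (α n + β)⁻³ ≤ β⁻³ + 1/(α β²)` give the uniform bound on all finite partial sums, whence summability
(`summable_of_sum_le`) and the `tsum` bound. The in-layer family is dominated by `8 ×` the inverse-cube family at the
fictitious height `c = a²` off the origin (`‖i v₁ + j v₂‖² ≥ a²` there), the origin contributing `V_LJ 0 = 0`.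
All elementary. [folklore]
-/

noncomputable section

namespace Summit.AtomisticToContinuum.Crystallization.Theorems.PeriodicWindowsDenseLaminarHull

open Literature.MathematicalPhysics.StatisticalMechanics Filter Metric
open scoped BigOperators

/-! ## Counting points of a shifted triangular lattice -/

/-- **Cumulative planar count, arbitrary real shifts**: in any finite `F ⊆ ℤ²`, the points with
`(i + j/2 + c₁)² + ¾ (j + c₂)² < m` (`m ≥ 1`) number at most `10 m` (the `j`-coordinate ranges over an interval of
length `4√(m/3)`, and for fixed `j` the `i`-coordinate over one of length `2√m`). [folklore] -/
theorem old_card_filter_lt_le (c₁ c₂ : ℝ) (F : Finset (ℤ × ℤ)) {m : ℝ} (hm : 1 ≤ m) :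
    ((F.filter fun ij : ℤ × ℤ =>
        ((ij.1 : ℝ) + ij.2 / 2 + c₁) ^ 2 + 3 / 4 * ((ij.2 : ℝ) + c₂) ^ 2 < m).card : ℝ) ≤ 10 * m := by
  classical
  -- adapted from `card_filter_planarForm_lt_le` (registry shifts `δ/2`, `δ/3`) to real shifts `c₁`, `c₂`
  have card_Icc_le : ∀ (c r : ℝ), 0 ≤ r → ((Finset.Icc ⌈c - r⌉ ⌊c + r⌋).card : ℝ) ≤ 2 * r + 1 := by
    intro c r hr
    rw [Int.card_Icc]
    have h1 : (⌊c + r⌋ : ℝ) ≤ c + r := Int.floor_le _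
    have h2 : c - r ≤ (⌈c - r⌉ : ℝ) := Int.le_ceil _
    rcases le_or_gt (⌊c + r⌋ + 1 - ⌈c - r⌉) 0 with h | h
    · rw [Int.toNat_of_nonpos h]; simp; linarith
    · rw [show (((⌊c + r⌋ + 1 - ⌈c - r⌉).toNat : ℕ) : ℝ) = ((⌊c + r⌋ + 1 - ⌈c - r⌉ : ℤ) : ℝ) by
        rw [← Int.cast_natCast, Int.toNat_of_nonneg h.le]]
      push_cast; linarith
  set r₁ : ℝ := Real.sqrt m with hr₁
  set r₂ : ℝ := 2 * Real.sqrt (m / 3) with hr₂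
  have hr₁0 : 0 ≤ r₁ := Real.sqrt_nonneg _
  have hr₂0 : 0 ≤ r₂ := by positivity
  -- the `j`-range and, for each `j`, the `i`-range
  set J : Finset ℤ := Finset.Icc ⌈-c₂ - r₂⌉ ⌊-c₂ + r₂⌋ with hJ
  set I : ℤ → Finset ℤ := fun j => Finset.Icc ⌈(-(j : ℝ) / 2 - c₁) - r₁⌉ ⌊(-(j : ℝ) / 2 - c₁) + r₁⌋ with hI
  set G : Finset (ℤ × ℤ) := J.biUnion fun j => (I j).image fun i => (i, j) with hG
  have hsub : (F.filter fun ij : ℤ × ℤ =>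
      ((ij.1 : ℝ) + ij.2 / 2 + c₁) ^ 2 + 3 / 4 * ((ij.2 : ℝ) + c₂) ^ 2 < m) ⊆ G := by
    intro ij hij
    rw [Finset.mem_filter] at hij
    obtain ⟨-, hlt⟩ := hij
    have hX : |(ij.1 : ℝ) - (-(ij.2 : ℝ) / 2 - c₁)| < r₁ := by
      rw [show (ij.1 : ℝ) - (-(ij.2 : ℝ) / 2 - c₁) = ij.1 + ij.2 / 2 + c₁ by ring]
      refine abs_lt_of_sq_lt_sq ?_ hr₁0
      rw [hr₁, Real.sq_sqrt (by linarith)]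
      nlinarith [sq_nonneg ((ij.2 : ℝ) + c₂)]
    have hY : |(ij.2 : ℝ) - (-c₂)| < r₂ := by
      rw [show (ij.2 : ℝ) - (-c₂) = ij.2 + c₂ by ring]
      refine abs_lt_of_sq_lt_sq ?_ hr₂0
      rw [hr₂, mul_pow, Real.sq_sqrt (by positivity)]
      nlinarith [sq_nonneg ((ij.1 : ℝ) + ij.2 / 2 + c₁)]
    rw [hG, Finset.mem_biUnion]
    exact ⟨ij.2, mem_Icc_ceil_floor hY, Finset.mem_image.2 ⟨ij.1, mem_Icc_ceil_floor hX, rfl⟩⟩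
  have hcardG : (G.card : ℝ) ≤ (2 * r₂ + 1) * (2 * r₁ + 1) := by
    calc (G.card : ℝ) ≤ ∑ j ∈ J, (((I j).image fun i => (i, j)).card : ℝ) := by
          exact_mod_cast Finset.card_biUnion_le
      _ ≤ ∑ _j ∈ J, (2 * r₁ + 1) := by
          refine Finset.sum_le_sum fun j _ => ?_
          calc ((((I j).image fun i => (i, j)).card : ℕ) : ℝ) ≤ ((I j).card : ℝ) := by
                exact_mod_cast Finset.card_image_le
            _ ≤ 2 * r₁ + 1 := card_Icc_le _ _ hr₁0
      _ = J.card * (2 * r₁ + 1) := by rw [Finset.sum_const, nsmul_eq_mul]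
      _ ≤ (2 * r₂ + 1) * (2 * r₁ + 1) := by
          gcongr
          exact card_Icc_le _ _ hr₂0
  -- numerics: `(2 r₂ + 1)(2 r₁ + 1) ≤ 10 m` using `r₁ = √m ≤ m`, `r₂ = 2√(m/3)`, `m ≥ 1`
  have hsq1 : r₁ ^ 2 = m := Real.sq_sqrt (by linarith)
  have hsq2 : r₂ ^ 2 = 4 * (m / 3) := by rw [hr₂, mul_pow, Real.sq_sqrt (by positivity)]; ring
  have hr₁1 : 1 ≤ r₁ := by rw [hr₁]; exact Real.one_le_sqrt.2 hm
  have hr₁m : r₁ ≤ m := by nlinarith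
  have hr₂r₁ : r₂ ≤ 6 / 5 * r₁ := by nlinarith
  calc ((F.filter fun ij : ℤ × ℤ =>
        ((ij.1 : ℝ) + ij.2 / 2 + c₁) ^ 2 + 3 / 4 * ((ij.2 : ℝ) + c₂) ^ 2 < m).card : ℝ)
      ≤ G.card := by exact_mod_cast Finset.card_le_card hsub
    _ ≤ (2 * r₂ + 1) * (2 * r₁ + 1) := hcardG
    _ ≤ 10 * m := by nlinarith

/-! ## Layer-cake summation of an inverse-cube sum -/

/-- **Layer-cake bound for an inverse-cube sum.** If `Q ≥ 0` on `ℤ²` has cumulative counts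
`#{x ∈ F : Q x < m} ≤ 10 m` (`m ≥ 1`, every finite `F`), then for `α, c > 0` and every finite `F`,
`∑_{x ∈ F} ((α Q x + c)³)⁻¹ ≤ 10 (c⁻³ + 1/(α c²))` (levels `⌊Q⌋₊`, `sum_le_of_cumulative_count`, and the telescoping
estimate `sum_range_inv_cube_affine_le`). [folklore] -/
theorem old_sum_inv_cube_le {α c : ℝ} (hα : 0 < α) (hc : 0 < c) (Q : ℤ × ℤ → ℝ) (hQ0 : ∀ x, 0 ≤ Q x)
    (hcount : ∀ (F : Finset (ℤ × ℤ)) (m : ℝ), 1 ≤ m → ((F.filter fun x => Q x < m).card : ℝ) ≤ 10 * m)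
    (F : Finset (ℤ × ℤ)) :
    ∑ x ∈ F, ((α * Q x + c) ^ 3)⁻¹ ≤ 10 * ((c ^ 3)⁻¹ + 1 / (α * c ^ 2)) := by
  classical
  set f : ℕ → ℝ := fun n => ((α * n + c) ^ 3)⁻¹ with hf
  have hf_anti : ∀ n, f (n + 1) ≤ f n := fun n => by
    have hpos : 0 < α * (n : ℝ) + c := by positivity
    refine inv_anti₀ (pow_pos hpos 3) ?_
    gcongr
    linarith
  have hf0 : ∀ n, 0 ≤ f n := fun n => by positivity
  set t : ℤ × ℤ → ℕ := fun x => ⌊Q x⌋₊ with ht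
  -- per-point bound through the level `⌊Q x⌋₊`
  have hpt : ∀ x, ((α * Q x + c) ^ 3)⁻¹ ≤ f (t x) := fun x => by
    have h1 : (t x : ℝ) ≤ Q x := Nat.floor_le (hQ0 x)
    have hpos : 0 < α * (t x : ℝ) + c := by positivity
    exact inv_anti₀ (pow_pos hpos 3) (by gcongr)
  set T : ℕ := F.sup t with hT
  have htT : ∀ x ∈ F, t x ≤ T := fun x hx => Finset.le_sup hx
  have hcount' : ∀ m : ℕ, m ≤ T → ((F.filter fun x => t x ≤ m).card : ℝ) ≤ 10 * (m + 1) := by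
    intro m _
    have hsub : (F.filter fun x => t x ≤ m) ⊆ F.filter fun x => Q x < (m : ℝ) + 1 := by
      intro x hx
      rw [Finset.mem_filter] at hx ⊢
      refine ⟨hx.1, ?_⟩
      have h1 : Q x < (t x : ℝ) + 1 := Nat.lt_floor_add_one (Q x)
      have h2 : (t x : ℝ) ≤ m := by exact_mod_cast hx.2
      linarith
    calc ((F.filter fun x => t x ≤ m).card : ℝ) ≤ ((F.filter fun x => Q x < (m : ℝ) + 1).card : ℝ) := by
          exact_mod_cast Finset.card_le_card hsub
      _ ≤ 10 * ((m : ℝ) + 1) := hcount F _ (by linarith [m.cast_nonneg (α := ℝ)])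
  have hcake := sum_le_of_cumulative_count F t T htT hcount' f hf_anti (hf0 T)
  have hlevel : ∑ n ∈ Finset.range (T + 1), f n ≤ (c ^ 3)⁻¹ + 1 / (α * c ^ 2) :=
    sum_range_inv_cube_affine_le hα hc T
  calc ∑ x ∈ F, ((α * Q x + c) ^ 3)⁻¹ ≤ ∑ x ∈ F, f (t x) := Finset.sum_le_sum fun x _ => hpt x
    _ ≤ 10 * ∑ n ∈ Finset.range (T + 1), f n := hcake
    _ ≤ 10 * ((c ^ 3)⁻¹ + 1 / (α * c ^ 2)) := by gcongr

/-! ## The shifted layer in coordinates -/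

/-- **A point of the shifted layer in coordinates**: for horizontal `θ` and `a ≠ 0`, `i v₁ + j v₂ + θ` is horizontal and
`‖i v₁ + j v₂ + θ‖² = a² ((i + j/2 + c₁)² + ¾ (j + c₂)²)` with `c₁ = θ₀/a`, `c₂ = 2√3 θ₁/(3a)`. [folklore] -/
theorem old_norm_sq_horiz {a : ℝ} (ha : a ≠ 0) (θ : EuclideanSpace ℝ (Fin 3)) (hθ : θ 2 = 0) (i j : ℝ) :
    (i • triangularVec₁ a + j • triangularVec₂ a + θ) 2 = 0 ∧
    ‖i • triangularVec₁ a + j • triangularVec₂ a + θ‖ ^ 2 =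
      a ^ 2 * ((i + j / 2 + θ 0 / a) ^ 2 + 3 / 4 * (j + 2 * √3 * θ 1 / (3 * a)) ^ 2) := by
  have h2 : (i • triangularVec₁ a + j • triangularVec₂ a + θ) 2 = 0 := by
    rw [PiLp.add_apply, PiLp.add_apply, PiLp.smul_apply, PiLp.smul_apply, hθ, gsc_triangularVec₁_two,
      gsc_triangularVec₂_two]
    simp
  refine ⟨h2, ?_⟩
  have h0 : (i • triangularVec₁ a + j • triangularVec₂ a + θ) 0 = i * a + j * (a / 2) + θ 0 := by
    simp [triangularVec₁, triangularVec₂]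
  have h1 : (i • triangularVec₁ a + j • triangularVec₂ a + θ) 1 = j * (a * √3 / 2) + θ 1 := by
    simp [triangularVec₁, triangularVec₂]
  rw [gsc_norm_sq_eq, h2, h0, h1]
  have h3 : (√3 : ℝ) ^ 2 = 3 := Real.sq_sqrt (by norm_num)
  field_simp
  linear_combination (12 * (j * a) ^ 2 - 16 * (θ 1) ^ 2) * h3

/-! ## The inverse-cube sum and the Lennard-Jones sum over a shifted layer -/

/-- **The inverse-cube sum over a shifted layer.** For `a ≥ 7/10`, horizontal `θ`, `c > 0` and any finite `F ⊆ ℤ²`: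
`∑_{(i,j) ∈ F} ((‖i v₁ + j v₂ + θ‖² + c)³)⁻¹ ≤ 10 (c⁻³ + 1/(a² c²))`, uniformly in `θ`. [folklore] -/
theorem old_sum_layer_inv_cube_le {a : ℝ} (ha : (7 : ℝ) / 10 ≤ a) (θ : EuclideanSpace ℝ (Fin 3)) (hθ : θ 2 = 0)
    {c : ℝ} (hc : 0 < c) (F : Finset (ℤ × ℤ)) :
    ∑ ij ∈ F, ((‖((ij.1 : ℝ)) • triangularVec₁ a + ((ij.2 : ℝ)) • triangularVec₂ a + θ‖ ^ 2 + c) ^ 3)⁻¹ ≤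
      10 * ((c ^ 3)⁻¹ + 1 / (a ^ 2 * c ^ 2)) := by
  have ha0 : 0 < a := by linarith
  set Q : ℤ × ℤ → ℝ := fun ij =>
    ((ij.1 : ℝ) + ij.2 / 2 + θ 0 / a) ^ 2 + 3 / 4 * ((ij.2 : ℝ) + 2 * √3 * θ 1 / (3 * a)) ^ 2 with hQ
  have hnorm : ∀ ij : ℤ × ℤ, ‖((ij.1 : ℝ)) • triangularVec₁ a + ((ij.2 : ℝ)) • triangularVec₂ a + θ‖ ^ 2 =
      a ^ 2 * Q ij := fun ij => (old_norm_sq_horiz ha0.ne' θ hθ _ _).2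
  calc ∑ ij ∈ F, ((‖((ij.1 : ℝ)) • triangularVec₁ a + ((ij.2 : ℝ)) • triangularVec₂ a + θ‖ ^ 2 + c) ^ 3)⁻¹
      = ∑ ij ∈ F, ((a ^ 2 * Q ij + c) ^ 3)⁻¹ := Finset.sum_congr rfl fun ij _ => by rw [hnorm]
    _ ≤ 10 * ((c ^ 3)⁻¹ + 1 / (a ^ 2 * c ^ 2)) :=
        old_sum_inv_cube_le (by positivity) hc Q (fun _ => by positivity)
          (fun F m hm => old_card_filter_lt_le _ _ F hm) F

/-- **Uniform decay of the shifted layer sums (finite partial sums).** For `a ≥ 7/10`, horizontal `θ`, `|H| ≥ 7/10`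
and any finite `F ⊆ ℤ²`: `∑_{F} |V_LJ ‖i v₁ + j v₂ + θ + H e₃‖| ≤ 10 (100/49 + a⁻²) / H⁴`. [folklore] -/
theorem old_sum_abs_layer_le {a : ℝ} (ha : (7 : ℝ) / 10 ≤ a) (θ : EuclideanSpace ℝ (Fin 3)) (hθ : θ 2 = 0)
    {H : ℝ} (hH : (7 : ℝ) / 10 ≤ |H|) (F : Finset (ℤ × ℤ)) :
    ∑ ij ∈ F, |lennardJones ‖((ij.1 : ℝ)) • triangularVec₁ a + ((ij.2 : ℝ)) • triangularVec₂ a + θ +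
        H • layerNormal 1‖| ≤ 10 * (100 / 49 + 1 / a ^ 2) / H ^ 4 := by
  have ha0 : 0 < a := by linarith
  have hH2 : 49 / 100 ≤ H ^ 2 := by rw [← sq_abs]; nlinarith
  have hH2pos : 0 < H ^ 2 := by linarith
  -- Pythagoras: horizontal part plus `H e₃`
  have hsq : ∀ ij : ℤ × ℤ, ‖((ij.1 : ℝ)) • triangularVec₁ a + ((ij.2 : ℝ)) • triangularVec₂ a + θ +
      H • layerNormal 1‖ ^ 2 =
      ‖((ij.1 : ℝ)) • triangularVec₁ a + ((ij.2 : ℝ)) • triangularVec₂ a + θ‖ ^ 2 + H ^ 2 := fun ij =>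
    gsc_norm_sq_horiz_add _ (old_norm_sq_horiz ha0.ne' θ hθ _ _).1 H
  have hpt : ∀ ij : ℤ × ℤ, |lennardJones ‖((ij.1 : ℝ)) • triangularVec₁ a + ((ij.2 : ℝ)) • triangularVec₂ a + θ +
      H • layerNormal 1‖| ≤
      ((‖((ij.1 : ℝ)) • triangularVec₁ a + ((ij.2 : ℝ)) • triangularVec₂ a + θ‖ ^ 2 + H ^ 2) ^ 3)⁻¹ := by
    intro ij
    have h49 : 49 / 100 ≤ ‖((ij.1 : ℝ)) • triangularVec₁ a + ((ij.2 : ℝ)) • triangularVec₂ a + θ +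
        H • layerNormal 1‖ ^ 2 := by
      rw [hsq]
      nlinarith [sq_nonneg ‖((ij.1 : ℝ)) • triangularVec₁ a + ((ij.2 : ℝ)) • triangularVec₂ a + θ‖]
    have h := LayeredHull.cake_abs_lennardJones_le h49
    rwa [hsq, inv_pow] at h
  have h4 : H ^ 4 = (H ^ 2) ^ 2 := by ring
  calc ∑ ij ∈ F, |lennardJones ‖((ij.1 : ℝ)) • triangularVec₁ a + ((ij.2 : ℝ)) • triangularVec₂ a + θ +
        H • layerNormal 1‖|
      ≤ ∑ ij ∈ F, ((‖((ij.1 : ℝ)) • triangularVec₁ a + ((ij.2 : ℝ)) • triangularVec₂ a + θ‖ ^ 2 + H ^ 2) ^ 3)⁻¹ :=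
        Finset.sum_le_sum fun ij _ => hpt ij
    _ ≤ 10 * (((H ^ 2) ^ 3)⁻¹ + 1 / (a ^ 2 * (H ^ 2) ^ 2)) := old_sum_layer_inv_cube_le ha θ hθ hH2pos F
    _ ≤ 10 * (100 / 49 / H ^ 4 + 1 / a ^ 2 / H ^ 4) := by
        gcongr 10 * (?_ + ?_)
        · rw [h4, inv_eq_one_div, div_le_div_iff₀ (by positivity) (by positivity)]
          nlinarith [mul_nonneg (sq_nonneg (H ^ 2)) (show (0 : ℝ) ≤ 100 / 49 * H ^ 2 - 1 by linarith)]
        · rw [h4, div_div]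
    _ = 10 * (100 / 49 + 1 / a ^ 2) / H ^ 4 := by ring

/-! ## The in-layer family -/

/-- **Absolute summability of the in-layer family** `|V_LJ ‖i v₁ + j v₂‖|` for `a ≥ 7/10`: the origin contributes
`V_LJ 0 = 0`; off the origin `‖i v₁ + j v₂‖² ≥ a² ≥ 49/100`, and the term is dominated by `8 ×` the inverse-cube term
at the fictitious squared height `c = a²`. [folklore] -/
theorem old_summable_abs_inLayer {a : ℝ} (ha : (7 : ℝ) / 10 ≤ a) :
    Summable fun ij : ℤ × ℤ =>
      |lennardJones ‖((ij.1 : ℝ)) • triangularVec₁ a + ((ij.2 : ℝ)) • triangularVec₂ a‖| := by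
  have ha0 : 0 < a := by linarith
  have ha2 : 0 < a ^ 2 := by positivity
  have h02 : (0 : EuclideanSpace ℝ (Fin 3)) 2 = 0 := rfl
  have hT : Summable (fun ij : ℤ × ℤ => 8 * ((‖((ij.1 : ℝ)) • triangularVec₁ a + ((ij.2 : ℝ)) • triangularVec₂ a +
      (0 : EuclideanSpace ℝ (Fin 3))‖ ^ 2 + a ^ 2) ^ 3)⁻¹) :=
    (summable_of_sum_le (fun _ => by positivity) (fun F => old_sum_layer_inv_cube_le ha 0 h02 ha2 F)).mul_left 8
  refine Summable.of_nonneg_of_le (fun _ => abs_nonneg _) (fun ij => ?_) hT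
  rw [add_zero]
  rcases eq_or_ne (ij.1, ij.2) 0 with h0 | h0
  · have h1 : ij.1 = 0 ∧ ij.2 = 0 := by simpa [Prod.ext_iff] using h0
    have hn : ‖((ij.1 : ℝ)) • triangularVec₁ a + ((ij.2 : ℝ)) • triangularVec₂ a‖ = 0 := by
      rw [h1.1, h1.2]; simp
    rw [hn, lennardJones_zero, abs_zero]
    positivity
  · set S := ‖((ij.1 : ℝ)) • triangularVec₁ a + ((ij.2 : ℝ)) • triangularVec₂ a‖ ^ 2 with hS
    have hSa : a ^ 2 ≤ S := by
      have h := LayeredHull.cake_le_norm_layerVec_inLayer a ha0.le h0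
      rw [LayeredHull.cake_layerVec_height_zero] at h
      exact pow_le_pow_left₀ ha0.le h 2
    have hS49 : 49 / 100 ≤ S := le_trans (by nlinarith) hSa
    have hSpos : 0 < S := by linarith
    have hinv : S⁻¹ ≤ ((S + a ^ 2) / 2)⁻¹ := inv_anti₀ (by positivity) (by linarith)
    calc |lennardJones ‖((ij.1 : ℝ)) • triangularVec₁ a + ((ij.2 : ℝ)) • triangularVec₂ a‖| ≤ (S⁻¹) ^ 3 :=
          LayeredHull.cake_abs_lennardJones_le hS49
      _ ≤ (((S + a ^ 2) / 2)⁻¹) ^ 3 := pow_le_pow_left₀ (by positivity) hinv 3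
      _ = 8 * ((S + a ^ 2) ^ 3)⁻¹ := by
          rw [inv_div, div_pow, inv_eq_one_div]
          ring

/-! ## The registered stub -/

/-- **Stub LC-B `stub_offsetLayerDecay`.** For `a ≥ 7/10`: (1) the in-layer family `|V_LJ ‖i v₁(a) + j v₂(a)‖|` is
summable over `ℤ²`; (2) there is `C = C(a)` (here `10 (100/49 + a⁻²)`) such that for every HORIZONTAL offset `θ` and
every height `|H| ≥ 7/10` the shifted layer family `|V_LJ ‖i v₁ + j v₂ + θ + H e₃‖|` is summable with
`∑' ≤ C / H⁴` (the general-offset analogue of `LayeredHull.cake_summable_abs_layer` and of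
`Literature…abs_layerInteraction_lennardJones_le`). [folklore] -/
theorem stub_offsetLayerDecay : ∀ a : ℝ, (7 : ℝ) / 10 ≤ a →
    (Summable fun ij : ℤ × ℤ => |lennardJones ‖((ij.1 : ℝ)) • triangularVec₁ a + ((ij.2 : ℝ)) • triangularVec₂ a‖|) ∧
    ∃ C : ℝ, ∀ (H : ℝ) (θ : EuclideanSpace ℝ (Fin 3)), θ 2 = 0 → (7 : ℝ) / 10 ≤ |H| →
      (Summable fun ij : ℤ × ℤ => |lennardJones ‖((ij.1 : ℝ)) • triangularVec₁ a + ((ij.2 : ℝ)) • triangularVec₂ a +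
        θ + H • layerNormal 1‖|) ∧
      (∑' ij : ℤ × ℤ, |lennardJones ‖((ij.1 : ℝ)) • triangularVec₁ a + ((ij.2 : ℝ)) • triangularVec₂ a +
        θ + H • layerNormal 1‖|) ≤ C / H ^ 4 := by
  intro a ha
  refine ⟨old_summable_abs_inLayer ha, 10 * (100 / 49 + 1 / a ^ 2), fun H θ hθ hH => ?_⟩
  have hle := old_sum_abs_layer_le ha θ hθ hH
  exact ⟨summable_of_sum_le (fun _ => abs_nonneg _) hle, Real.tsum_le_of_sum_le (fun _ => abs_nonneg _) hle⟩

end Summit.AtomisticToContinuum.Crystallization.Theorems.PeriodicWindowsDenseLaminarHull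

end
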